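import Mathlib
import Literature.Analysis.FluidPDE.VectorCalculus
import Summits.NavierStokesRegularity.NavierStokesRegularity.Theorems.FilamentSkeletonRssClause13REdgeMeasureModel

/-!
# Clause 13-R, repaired item (c′) at MODEL level — CONVERSE: an annihilating edge measure forces the SOURCED adjoint equation
# (crux `Clause13RNearStraightL`, stmt-NavierStokesRegularity-23612; line `rate_bordered_split`, STUB R `stub_rateRow13RFlat`)

Route `FilamentSkeletonRss`, Variant A1R.  Companion of `…Clause13REdgeMeasureModel` (same forward model operator `L`, same edge measure
`μ = e₊δ_b + e₋δ_a + φ dσ`, same sourced adjoint equation).  There: the sourced equation ⟹ `μ` annihilates `LY` for every `C²` field `Y` vanishing off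
`S = [a,b]`.  HERE:
* `edgeMeasure_pairing_eq` — the pairing identity WITHOUT any equation: `∫_a^b⟪φ, LY⟫ + ⟪e₊,(LY)(b)⟫ + ⟪e₋,(LY)(a)⟫ = ∫_a^b ⟪G, Y⟫`, where
  `G = (adjoint operator)φ − cst•(k(·−b)•(e₊×d) + k(·−a)•(e₋×d))` (clamping at the endpoints, Fubini with the even kernel, transport by parts);
* `edgeMeasure_density_unique` (§3) — two `C¹` solutions of the sourced equation coincide (`w′ ≥ −1+2ε`): (c′) is a pure existence/size question;
* `sourced_eq_of_edgeMeasure_annihilates` — the CONVERSE: if `μ` annihilates `LY` for every such `Y` then `G = 0` on all of `S` (fundamental lemma of the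
  calculus of variations, Mathlib `IsOpen.ae_eq_zero_of_integral_contDiff_smul_eq_zero`, then continuity up to the endpoints).
So, at model level and within this class of measures, «annihilating edge measure» ⟺ «density solving the sourced adjoint equation»: the repaired census
item (c′) of memo STRUCTURE-23612-edge-measures-leafhand16-g0.md is exactly the solvability of that equation (uniqueness: `…Clause13RAdjointEnergy`).
[folklore]  Hand `leafhand-ns-filamentskeletonrs-16-g0` (LAND-ONLY); `--supports stmt-NavierStokesRegularity-23612` helper, def-free.  HONEST FRAMING: duality
bookkeeping for the MODEL of a HYPOTHETICAL filament skeleton on the NEGATIVE side of a MODEL blow-up route; STUB R is NOT proved, nothing here bears on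
Navier–Stokes regularity or blow-up.
-/

noncomputable section

open MeasureTheory Filter Topology Set intervalIntegral
open scoped RealInnerProductSpace InnerProductSpace ContDiff
open Literature.Analysis.FluidPDE
open Summit.NavierStokesRegularity.NavierStokesRegularity.Theorems.Clause13REdgeMeasureModel

namespace Summit.NavierStokesRegularity.NavierStokesRegularity.Theorems.Clause13REdgeMeasureModelConverse
set_option linter.dupNamespace false

/-! ## §1 The pairing identity (no equation) and §2 the converse -/

/-- **Pairing identity for an edge measure (no equation assumed).**  For every `C¹` weight `φ`, atoms `e₊, e₋` and every `C²` field `Y` vanishing off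
`S = [a,b]`: `∫_a^b ⟪φ, LY⟫ + ⟪e₊, (LY)(b)⟫ + ⟪e₋, (LY)(a)⟫ = ∫_a^b ⟪G, Y⟫` with
`G = cst • (m • (φ × d) − ∫_S k(σ−·) • (φ σ × d) dσ) + ½φ + α e × φ + w′φ + wφ′ − cst • (k(·−b) • (e₊ × d) + k(·−a) • (e₋ × d))`
(the adjoint operator applied to `φ` minus the edge sources). [folklore] -/
theorem edgeMeasure_pairing_eq {a b cst α : ℝ} (hab : a < b) {k m w w' : ℝ → ℝ} {φ φ' : ℝ → EuclideanSpace ℝ (Fin 3)}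
    {d e ep em : EuclideanSpace ℝ (Fin 3)}
    (hk : Continuous k) (hkev : ∀ s, k (-s) = k s) (hm : Continuous m)
    (hw : ∀ σ, HasDerivAt w (w' σ) σ) (hφ : ∀ σ, HasDerivAt φ (φ' σ) σ) (hw'c : Continuous w') (hφ'c : Continuous φ')
    {Y : ℝ → EuclideanSpace ℝ (Fin 3)} (hY : ContDiff ℝ 2 Y) (hoff : ∀ τ, τ ∉ Icc a b → Y τ = 0) :
    (∫ σ in a..b, ⟪φ σ, cst • (m σ • cross d (Y σ) - ∫ τ in Icc a b, k (τ - σ) • cross d (Y τ))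
        + (1 / 2 : ℝ) • Y σ - α • cross e (Y σ) - w σ • deriv Y σ⟫)
      + ⟪ep, cst • (m b • cross d (Y b) - ∫ τ in Icc a b, k (τ - b) • cross d (Y τ))
        + (1 / 2 : ℝ) • Y b - α • cross e (Y b) - w b • deriv Y b⟫
      + ⟪em, cst • (m a • cross d (Y a) - ∫ τ in Icc a b, k (τ - a) • cross d (Y τ))
        + (1 / 2 : ℝ) • Y a - α • cross e (Y a) - w a • deriv Y a⟫
    = ∫ τ in a..b, ⟪cst • (m τ • cross (φ τ) d - ∫ σ in Icc a b, k (σ - τ) • cross (φ σ) d)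
        + (1 / 2 : ℝ) • φ τ + α • cross e (φ τ) + w' τ • φ τ + w τ • φ' τ
        - cst • (k (τ - b) • cross ep d + k (τ - a) • cross em d), Y τ⟫ := by
  have hwc : Continuous w := continuous_iff_continuousAt.2 fun σ => (hw σ).continuousAt
  have hφc : Continuous φ := continuous_iff_continuousAt.2 fun σ => (hφ σ).continuousAt
  have hYc : Continuous Y := hY.continuous
  have hY'c : Continuous (deriv Y) := hY.continuous_deriv (by norm_num)
  have hYd : ∀ σ, HasDerivAt Y (deriv Y σ) σ := fun σ => (hY.differentiable (by norm_num) σ).hasDerivAt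
  obtain ⟨hYa, hY'a, hYb, hY'b⟩ := clamped_endpoints hY hoff
  have hrot : ∀ x y : EuclideanSpace ℝ (Fin 3), ⟪x, cross e y⟫ = -⟪cross e x, y⟫ := fun x y => by
    simp only [cross, cross_apply, PiLp.inner_apply, RCLike.inner_apply, conj_trivial, Fin.sum_univ_three,
      Matrix.cons_val_zero, Matrix.cons_val_one, Matrix.cons_val_two, Matrix.head_cons, Matrix.tail_cons]
    ring
  -- atoms = pure leaks
  rw [model_forward_at_clamped (Y' := deriv Y) hYb hY'b, model_forward_at_clamped (Y' := deriv Y) hYa hY'a]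
  -- continuity of the building blocks
  have hcrossY : Continuous fun τ => cross d (Y τ) := by
    have : Continuous fun τ => crossCLM d (Y τ) := (crossCLM.continuous₂).comp₂ continuous_const hYc
    simpa only [crossCLM_apply] using this
  have hcrossφ : Continuous fun σ => cross (φ σ) d := by
    have : Continuous fun σ => crossCLM (φ σ) d := (crossCLM.continuous₂).comp₂ hφc continuous_const
    simpa only [crossCLM_apply] using this
  have hcrosseY : Continuous fun τ => cross e (Y τ) := by
    have : Continuous fun τ => crossCLM e (Y τ) := (crossCLM.continuous₂).comp₂ continuous_const hYc
    simpa only [crossCLM_apply] using this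
  have hc1 : Continuous fun σ => cst • (m σ • cross (φ σ) d) + (1 / 2 : ℝ) • φ σ + α • cross e (φ σ) := by
    have hce : Continuous fun σ => cross e (φ σ) := by
      have : Continuous fun σ => crossCLM e (φ σ) := (crossCLM.continuous₂).comp₂ continuous_const hφc
      simpa only [crossCLM_apply] using this
    have h1 : Continuous fun σ => cst • (m σ • cross (φ σ) d) := (hm.smul hcrossφ).const_smul cst
    have h2 : Continuous fun σ => (1 / 2 : ℝ) • φ σ := hφc.const_smul (1 / 2 : ℝ)
    have h3 : Continuous fun σ => α • cross e (φ σ) := hce.const_smul α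
    exact (h1.add h2).add h3
  have hNY : Continuous fun σ => ∫ τ in Icc a b, k (τ - σ) • cross d (Y τ) := by
    have hj : Continuous (Function.uncurry fun σ τ => k (τ - σ) • cross d (Y τ)) :=
      (hk.comp (continuous_snd.sub continuous_fst)).smul (hcrossY.comp continuous_snd)
    exact continuous_parametric_integral_of_continuous hj isCompact_Icc
  have hNφ : Continuous fun τ => ∫ σ in Icc a b, k (σ - τ) • cross (φ σ) d := by
    have hj : Continuous (Function.uncurry fun τ σ => k (σ - τ) • cross (φ σ) d) :=
      (hk.comp (continuous_snd.sub continuous_fst)).smul (hcrossφ.comp continuous_snd)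
    exact continuous_parametric_integral_of_continuous hj isCompact_Icc
  -- Step 1: split the interval integral into local algebraic part, nonlocal part and transport part
  have hsplit : ∀ σ, ⟪φ σ, cst • (m σ • cross d (Y σ) - ∫ τ in Icc a b, k (τ - σ) • cross d (Y τ))
        + (1 / 2 : ℝ) • Y σ - α • cross e (Y σ) - w σ • deriv Y σ⟫
      = ⟪cst • (m σ • cross (φ σ) d) + (1 / 2 : ℝ) • φ σ + α • cross e (φ σ), Y σ⟫
        - cst * ⟪φ σ, ∫ τ in Icc a b, k (τ - σ) • cross d (Y τ)⟫ + ⟪φ σ, -(w σ • deriv Y σ)⟫ := by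
    intro σ
    simp only [inner_add_right, inner_sub_right, inner_smul_right, inner_add_left, inner_smul_left, conj_trivial, inner_neg_right,
      inner_cross_transpose (φ σ) d (Y σ), hrot (φ σ) (Y σ)]
    ring
  have hI : ∫ σ in a..b, ⟪φ σ, cst • (m σ • cross d (Y σ) - ∫ τ in Icc a b, k (τ - σ) • cross d (Y τ))
        + (1 / 2 : ℝ) • Y σ - α • cross e (Y σ) - w σ • deriv Y σ⟫
      = (∫ σ in a..b, ⟪cst • (m σ • cross (φ σ) d) + (1 / 2 : ℝ) • φ σ + α • cross e (φ σ), Y σ⟫)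
        - cst * (∫ σ in a..b, ⟪φ σ, ∫ τ in Icc a b, k (τ - σ) • cross d (Y τ)⟫)
        + ∫ σ in a..b, ⟪φ σ, -(w σ • deriv Y σ)⟫ := by
    have hi1 : IntervalIntegrable (fun σ => ⟪cst • (m σ • cross (φ σ) d) + (1 / 2 : ℝ) • φ σ + α • cross e (φ σ), Y σ⟫) volume a b :=
      (hc1.inner hYc).intervalIntegrable _ _
    have hi2 : IntervalIntegrable (fun σ => cst * ⟪φ σ, ∫ τ in Icc a b, k (τ - σ) • cross d (Y τ)⟫) volume a b :=
      (continuous_const.mul (hφc.inner hNY)).intervalIntegrable _ _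
    have hi3 : IntervalIntegrable (fun σ => ⟪φ σ, -(w σ • deriv Y σ)⟫) volume a b :=
      (hφc.inner (hwc.smul hY'c).neg).intervalIntegrable _ _
    rw [intervalIntegral.integral_congr (fun σ _ => hsplit σ), intervalIntegral.integral_add (hi1.sub hi2) hi3,
      intervalIntegral.integral_sub hi1 hi2, intervalIntegral.integral_const_mul]
  -- Step 2: nonlocal part by Fubini, transport part by parts
  have hN : ∫ σ in a..b, ⟪φ σ, ∫ τ in Icc a b, k (τ - σ) • cross d (Y τ)⟫
      = ∫ τ in a..b, ⟪∫ σ in Icc a b, k (σ - τ) • cross (φ σ) d, Y τ⟫ := by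
    rw [integral_of_le hab.le, integral_of_le hab.le, ← integral_Icc_eq_integral_Ioc, ← integral_Icc_eq_integral_Ioc]
    exact setIntegral_inner_nonlocal_swap hk hkev hφc hYc d
  have hT := integral_transport_pairing hw hφ hYd hw'c hφ'c hY'c hYa hYb
  rw [hI, hN, hT]
  -- Step 3: the atoms as integrals against `Y`
  have hatom : ∀ (x : ℝ) (ee : EuclideanSpace ℝ (Fin 3)),
      ⟪ee, -(cst • ∫ τ in Icc a b, k (τ - x) • cross d (Y τ))⟫ = -(cst * ∫ τ in a..b, ⟪k (τ - x) • cross ee d, Y τ⟫) := by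
    intro x ee
    have hint : IntegrableOn (fun τ => k (τ - x) • cross d (Y τ)) (Icc a b) :=
      ((hk.comp (continuous_id.sub continuous_const)).smul hcrossY).continuousOn.integrableOn_compact isCompact_Icc
    rw [inner_neg_right, inner_smul_right, ← integral_inner hint ee, integral_of_le hab.le, ← integral_Icc_eq_integral_Ioc]
    congr 2
    refine integral_congr_ae (Eventually.of_forall fun τ => ?_)
    simp only [inner_smul_right, inner_smul_left, conj_trivial, inner_cross_transpose]
  rw [hatom b ep, hatom a em]
  -- Step 4: the right-hand side splits into the same five integrals
  have hi1 : IntervalIntegrable (fun σ => ⟪cst • (m σ • cross (φ σ) d) + (1 / 2 : ℝ) • φ σ + α • cross e (φ σ), Y σ⟫) volume a b :=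
    (hc1.inner hYc).intervalIntegrable _ _
  have hi2 : IntervalIntegrable (fun τ => ⟪∫ σ in Icc a b, k (σ - τ) • cross (φ σ) d, Y τ⟫) volume a b :=
    (hNφ.inner hYc).intervalIntegrable _ _
  have hi3 : IntervalIntegrable (fun σ => ⟪w' σ • φ σ + w σ • φ' σ, Y σ⟫) volume a b :=
    (((hw'c.smul hφc).add (hwc.smul hφ'c)).inner hYc).intervalIntegrable _ _
  have hi4 : ∀ (x : ℝ) (ee : EuclideanSpace ℝ (Fin 3)), IntervalIntegrable (fun τ => ⟪k (τ - x) • cross ee d, Y τ⟫) volume a b :=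
    fun x ee => (((hk.comp (continuous_id.sub continuous_const)).smul continuous_const).inner hYc).intervalIntegrable _ _
  have hRHS : ∫ τ in a..b, ⟪cst • (m τ • cross (φ τ) d - ∫ σ in Icc a b, k (σ - τ) • cross (φ σ) d)
        + (1 / 2 : ℝ) • φ τ + α • cross e (φ τ) + w' τ • φ τ + w τ • φ' τ
        - cst • (k (τ - b) • cross ep d + k (τ - a) • cross em d), Y τ⟫
      = ∫ τ in a..b, (⟪cst • (m τ • cross (φ τ) d) + (1 / 2 : ℝ) • φ τ + α • cross e (φ τ), Y τ⟫
          - cst * ⟪∫ σ in Icc a b, k (σ - τ) • cross (φ σ) d, Y τ⟫ + ⟪w' τ • φ τ + w τ • φ' τ, Y τ⟫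
          - cst * ⟪k (τ - b) • cross ep d, Y τ⟫ - cst * ⟪k (τ - a) • cross em d, Y τ⟫) := by
    refine intervalIntegral.integral_congr fun τ _ => ?_
    simp only [inner_sub_left, inner_add_left, inner_smul_left, conj_trivial]
    ring
  rw [hRHS, intervalIntegral.integral_sub ((((hi1.sub (hi2.const_mul cst)).add hi3).sub ((hi4 b ep).const_mul cst)))
      ((hi4 a em).const_mul cst), intervalIntegral.integral_sub (((hi1.sub (hi2.const_mul cst)).add hi3))
      ((hi4 b ep).const_mul cst), intervalIntegral.integral_add (hi1.sub (hi2.const_mul cst)) hi3,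
      intervalIntegral.integral_sub hi1 (hi2.const_mul cst), intervalIntegral.integral_const_mul,
      intervalIntegral.integral_const_mul, intervalIntegral.integral_const_mul]
  ring

/-- **CONVERSE: annihilation by an edge measure forces the sourced adjoint equation.**  If `e₊δ_b + e₋δ_a + φ dσ` (`φ ∈ C¹`) annihilates the forward model
operator on EVERY `C²` field vanishing off `S = [a,b]` (`a < b`), then `φ` solves the adjoint equation sourced by the edge kernels on all of `S`
(fundamental lemma of the calculus of variations, Mathlib `IsOpen.ae_eq_zero_of_integral_contDiff_smul_eq_zero`, plus continuity up to the endpoints).  With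
`edgeMeasure_annihilates` this makes the repaired item (c′) an EQUIVALENCE at model level: edge measures of this form annihilate `range L|clamped` iff the
density solves the sourced equation. [folklore] -/
theorem sourced_eq_of_edgeMeasure_annihilates {a b cst α : ℝ} (hab : a < b) {k m w w' : ℝ → ℝ} {φ φ' : ℝ → EuclideanSpace ℝ (Fin 3)}
    {d e ep em : EuclideanSpace ℝ (Fin 3)}
    (hk : Continuous k) (hkev : ∀ s, k (-s) = k s) (hm : Continuous m)
    (hw : ∀ σ, HasDerivAt w (w' σ) σ) (hφ : ∀ σ, HasDerivAt φ (φ' σ) σ) (hw'c : Continuous w') (hφ'c : Continuous φ')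
    (hann : ∀ Y : ℝ → EuclideanSpace ℝ (Fin 3), ContDiff ℝ 2 Y → (∀ τ, τ ∉ Icc a b → Y τ = 0) →
      (∫ σ in a..b, ⟪φ σ, cst • (m σ • cross d (Y σ) - ∫ τ in Icc a b, k (τ - σ) • cross d (Y τ))
          + (1 / 2 : ℝ) • Y σ - α • cross e (Y σ) - w σ • deriv Y σ⟫)
        + ⟪ep, cst • (m b • cross d (Y b) - ∫ τ in Icc a b, k (τ - b) • cross d (Y τ))
          + (1 / 2 : ℝ) • Y b - α • cross e (Y b) - w b • deriv Y b⟫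
        + ⟪em, cst • (m a • cross d (Y a) - ∫ τ in Icc a b, k (τ - a) • cross d (Y τ))
          + (1 / 2 : ℝ) • Y a - α • cross e (Y a) - w a • deriv Y a⟫ = 0) :
    ∀ τ ∈ Icc a b, cst • (m τ • cross (φ τ) d - ∫ σ in Icc a b, k (σ - τ) • cross (φ σ) d)
        + (1 / 2 : ℝ) • φ τ + α • cross e (φ τ) + w' τ • φ τ + w τ • φ' τ
        = cst • (k (τ - b) • cross ep d + k (τ - a) • cross em d) := by
  have hwc : Continuous w := continuous_iff_continuousAt.2 fun σ => (hw σ).continuousAt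
  have hφc : Continuous φ := continuous_iff_continuousAt.2 fun σ => (hφ σ).continuousAt
  -- the defect field `G` and its continuity
  set G : ℝ → EuclideanSpace ℝ (Fin 3) := fun τ => cst • (m τ • cross (φ τ) d - ∫ σ in Icc a b, k (σ - τ) • cross (φ σ) d)
        + (1 / 2 : ℝ) • φ τ + α • cross e (φ τ) + w' τ • φ τ + w τ • φ' τ
        - cst • (k (τ - b) • cross ep d + k (τ - a) • cross em d) with hGdef
  have hcrossφ : Continuous fun σ => cross (φ σ) d := by
    have : Continuous fun σ => crossCLM (φ σ) d := (crossCLM.continuous₂).comp₂ hφc continuous_const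
    simpa only [crossCLM_apply] using this
  have hce : Continuous fun σ => cross e (φ σ) := by
    have : Continuous fun σ => crossCLM e (φ σ) := (crossCLM.continuous₂).comp₂ continuous_const hφc
    simpa only [crossCLM_apply] using this
  have hNφ : Continuous fun τ => ∫ σ in Icc a b, k (σ - τ) • cross (φ σ) d := by
    have hj : Continuous (Function.uncurry fun τ σ => k (σ - τ) • cross (φ σ) d) :=
      (hk.comp (continuous_snd.sub continuous_fst)).smul (hcrossφ.comp continuous_snd)
    exact continuous_parametric_integral_of_continuous hj isCompact_Icc
  have hGc : Continuous G := by
    have h1 : Continuous fun τ => cst • (m τ • cross (φ τ) d - ∫ σ in Icc a b, k (σ - τ) • cross (φ σ) d) :=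
      ((hm.smul hcrossφ).sub hNφ).const_smul cst
    have h2 : Continuous fun τ => (1 / 2 : ℝ) • φ τ := hφc.const_smul (1 / 2 : ℝ)
    have h3 : Continuous fun τ => α • cross e (φ τ) := hce.const_smul α
    have h4 : Continuous fun τ => w' τ • φ τ + w τ • φ' τ := (hw'c.smul hφc).add (hwc.smul hφ'c)
    have h5 : Continuous fun τ => cst • (k (τ - b) • cross ep d + k (τ - a) • cross em d) :=
      (((hk.comp (continuous_id.sub continuous_const)).smul continuous_const).add
        ((hk.comp (continuous_id.sub continuous_const)).smul continuous_const)).const_smul cst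
    have : Continuous fun τ => cst • (m τ • cross (φ τ) d - ∫ σ in Icc a b, k (σ - τ) • cross (φ σ) d)
        + (1 / 2 : ℝ) • φ τ + α • cross e (φ τ) + (w' τ • φ τ + w τ • φ' τ)
        - cst • (k (τ - b) • cross ep d + k (τ - a) • cross em d) := (((h1.add h2).add h3).add h4).sub h5
    refine this.congr fun τ => ?_
    simp only [hGdef, add_assoc]
  -- scalar components vanish on the open interval, by the fundamental lemma
  have hcomp : ∀ v : EuclideanSpace ℝ (Fin 3), ∀ τ ∈ Icc a b, ⟪G τ, v⟫ = 0 := by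
    intro v
    have hfc : Continuous fun τ => ⟪G τ, v⟫ := hGc.inner continuous_const
    have hae : ∀ᵐ x ∂(volume : Measure ℝ), x ∈ Ioo a b → ⟪G x, v⟫ = 0 := by
      refine isOpen_Ioo.ae_eq_zero_of_integral_contDiff_smul_eq_zero (hfc.locallyIntegrable.locallyIntegrableOn _) ?_
      intro g hg hgs hgU
      have hY : ContDiff ℝ 2 (fun τ => g τ • v) := (hg.of_le (WithTop.coe_le_coe.mpr le_top)).smul contDiff_const
      have hoffY : ∀ τ, τ ∉ Icc a b → g τ • v = 0 := by
        intro τ hτ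
        have hg0 : g τ = 0 := image_eq_zero_of_notMem_tsupport fun h => hτ (Ioo_subset_Icc_self (hgU h))
        rw [hg0, zero_smul]
      have h0 := hann _ hY hoffY
      rw [edgeMeasure_pairing_eq hab hk hkev hm hw hφ hw'c hφ'c hY hoffY] at h0
      have hsupp : Function.support (fun x => g x • ⟪G x, v⟫) ⊆ Ioc a b := by
        intro x hx
        have hgx : g x ≠ 0 := by
          intro h0'
          exact hx (show g x • ⟪G x, v⟫ = 0 by rw [h0', zero_smul])
        exact Ioo_subset_Ioc_self (hgU (subset_tsupport _ hgx))
      rw [← intervalIntegral.integral_eq_integral_of_support_subset hsupp, ← h0]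
      refine intervalIntegral.integral_congr fun τ _ => ?_
      simp only [inner_smul_right, smul_eq_mul]
      rfl
    -- a.e. on the open interval + continuity ⇒ everywhere on the open interval
    have hopen : ∀ x ∈ Ioo a b, ⟪G x, v⟫ = 0 := by
      intro x hx
      by_contra hne
      set W : Set ℝ := Ioo a b ∩ {y | (fun τ => ⟪G τ, v⟫) y ≠ (fun _ => (0 : ℝ)) y} with hW
      have hWo : IsOpen W := isOpen_Ioo.inter (isOpen_ne_fun hfc continuous_const)
      have hWpos : 0 < volume W := hWo.measure_pos volume ⟨x, hx, hne⟩
      have hW0 : volume W = 0 := measure_eq_zero_iff_ae_notMem.2 (hae.mono fun y hy hyW => hyW.2 (hy hyW.1))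
      exact absurd hW0 hWpos.ne'
    -- up to the endpoints by continuity
    intro τ hτ
    have hcl : τ ∈ closure (Ioo a b) := by rw [closure_Ioo hab.ne]; exact hτ
    exact Clause13REdgeClamping.eq_zero_of_mem_closure hfc hopen hcl
  intro τ hτ
  have hG0 : G τ = 0 := by
    have h := hcomp (G τ) τ hτ
    exact inner_self_eq_zero.1 h
  have : G τ = cst • (m τ • cross (φ τ) d - ∫ σ in Icc a b, k (σ - τ) • cross (φ σ) d)
        + (1 / 2 : ℝ) • φ τ + α • cross e (φ τ) + w' τ • φ τ + w τ • φ' τ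
        - cst • (k (τ - b) • cross ep d + k (τ - a) • cross em d) := rfl
  rw [this] at hG0
  exact sub_eq_zero.1 hG0

/-! ## §3 Uniqueness of the density -/

open Summit.NavierStokesRegularity.NavierStokesRegularity.Theorems.Clause13RAdjointEnergy (model_adjoint_no_regular_annihilator) in
/-- **UNIQUENESS of the edge-measure density.**  For fixed atoms `e₊, e₋` (indeed for any fixed continuous source `h`), two `C¹` solutions on `S = [a,b]`
(`a < b`) of the sourced model adjoint equation coincide, provided `w(a) ≤ 0 ≤ w(b)` and `w′ ≥ −1 + 2ε` on `S`: the difference solves the homogeneous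
equation and `…Clause13RAdjointEnergy.model_adjoint_no_regular_annihilator` applies.  So the repaired item (c′) is a pure EXISTENCE (and size) question.
[folklore] -/
theorem edgeMeasure_density_unique {a b cst α ε : ℝ} (hab : a < b) (hε : 0 < ε) {k m w w' : ℝ → ℝ}
    {φ₁ φ₁' φ₂ φ₂' h : ℝ → EuclideanSpace ℝ (Fin 3)} {d e : EuclideanSpace ℝ (Fin 3)}
    (hk : Continuous k) (hkev : ∀ s, k (-s) = k s)
    (hw : ∀ σ, HasDerivAt w (w' σ) σ) (hw'c : Continuous w')
    (hφ₁ : ∀ σ, HasDerivAt φ₁ (φ₁' σ) σ) (hφ₁'c : Continuous φ₁') (hφ₂ : ∀ σ, HasDerivAt φ₂ (φ₂' σ) σ) (hφ₂'c : Continuous φ₂')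
    (hwa : w a ≤ 0) (hwb : 0 ≤ w b) (hgrowth : ∀ σ ∈ Icc a b, -1 + 2 * ε ≤ w' σ)
    (h₁ : ∀ σ ∈ Icc a b,
      cst • (m σ • cross (φ₁ σ) d - ∫ τ in Icc a b, k (τ - σ) • cross (φ₁ τ) d)
        + (1 / 2 : ℝ) • φ₁ σ + α • cross e (φ₁ σ) + w' σ • φ₁ σ + w σ • φ₁' σ = h σ)
    (h₂ : ∀ σ ∈ Icc a b,
      cst • (m σ • cross (φ₂ σ) d - ∫ τ in Icc a b, k (τ - σ) • cross (φ₂ τ) d)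
        + (1 / 2 : ℝ) • φ₂ σ + α • cross e (φ₂ σ) + w' σ • φ₂ σ + w σ • φ₂' σ = h σ) :
    ∀ σ ∈ Icc a b, φ₁ σ = φ₂ σ := by
  have hφ₁c : Continuous φ₁ := continuous_iff_continuousAt.2 fun σ => (hφ₁ σ).continuousAt
  have hφ₂c : Continuous φ₂ := continuous_iff_continuousAt.2 fun σ => (hφ₂ σ).continuousAt
  have hφ : ∀ σ, HasDerivAt (fun σ => φ₁ σ - φ₂ σ) (φ₁' σ - φ₂' σ) σ := fun σ => (hφ₁ σ).sub (hφ₂ σ)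
  have hφ'c : Continuous fun σ => φ₁' σ - φ₂' σ := hφ₁'c.sub hφ₂'c
  -- linearity of the cross product
  have hcsub : ∀ x y z : EuclideanSpace ℝ (Fin 3), cross (x - y) z = cross x z - cross y z := fun x y z => by
    rw [← crossCLM_apply, ← crossCLM_apply, ← crossCLM_apply, map_sub]; rfl
  have hcsub' : ∀ z x y : EuclideanSpace ℝ (Fin 3), cross z (x - y) = cross z x - cross z y := fun z x y => by
    rw [← crossCLM_apply, ← crossCLM_apply, ← crossCLM_apply, map_sub]
  -- integrability of the two nonlocal densities
  have hcross : ∀ {ψ : ℝ → EuclideanSpace ℝ (Fin 3)}, Continuous ψ → Continuous fun τ => cross (ψ τ) d := by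
    intro ψ hψ
    have : Continuous fun τ => crossCLM (ψ τ) d := (crossCLM.continuous₂).comp₂ hψ continuous_const
    simpa only [crossCLM_apply] using this
  have hint : ∀ {ψ : ℝ → EuclideanSpace ℝ (Fin 3)}, Continuous ψ → ∀ σ,
      IntegrableOn (fun τ => k (τ - σ) • cross (ψ τ) d) (Icc a b) := by
    intro ψ hψ σ
    exact ((hk.comp (continuous_id.sub continuous_const)).smul (hcross hψ)).continuousOn.integrableOn_compact isCompact_Icc
  -- the difference solves the homogeneous equation
  have heq : ∀ σ ∈ Icc a b,
      cst • (m σ • cross (φ₁ σ - φ₂ σ) d - ∫ τ in Icc a b, k (τ - σ) • cross (φ₁ τ - φ₂ τ) d)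
        + (1 / 2 : ℝ) • (φ₁ σ - φ₂ σ) + α • cross e (φ₁ σ - φ₂ σ) + w' σ • (φ₁ σ - φ₂ σ) + w σ • (φ₁' σ - φ₂' σ) = 0 := by
    intro σ hσ
    have hI : ∫ τ in Icc a b, k (τ - σ) • cross (φ₁ τ - φ₂ τ) d
        = (∫ τ in Icc a b, k (τ - σ) • cross (φ₁ τ) d) - ∫ τ in Icc a b, k (τ - σ) • cross (φ₂ τ) d := by
      rw [← integral_sub (hint hφ₁c σ) (hint hφ₂c σ)]
      refine integral_congr_ae (Eventually.of_forall fun τ => ?_)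
      simp only [hcsub, smul_sub]
    have H := h₁ σ hσ
    have H2 := h₂ σ hσ
    rw [hI, hcsub, hcsub']
    have : cst • (m σ • (cross (φ₁ σ) d - cross (φ₂ σ) d)
          - ((∫ τ in Icc a b, k (τ - σ) • cross (φ₁ τ) d) - ∫ τ in Icc a b, k (τ - σ) • cross (φ₂ τ) d))
        + (1 / 2 : ℝ) • (φ₁ σ - φ₂ σ) + α • (cross e (φ₁ σ) - cross e (φ₂ σ)) + w' σ • (φ₁ σ - φ₂ σ) + w σ • (φ₁' σ - φ₂' σ)
        = (cst • (m σ • cross (φ₁ σ) d - ∫ τ in Icc a b, k (τ - σ) • cross (φ₁ τ) d)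
            + (1 / 2 : ℝ) • φ₁ σ + α • cross e (φ₁ σ) + w' σ • φ₁ σ + w σ • φ₁' σ)
          - (cst • (m σ • cross (φ₂ σ) d - ∫ τ in Icc a b, k (τ - σ) • cross (φ₂ τ) d)
            + (1 / 2 : ℝ) • φ₂ σ + α • cross e (φ₂ σ) + w' σ • φ₂ σ + w σ • φ₂' σ) := by
      module
    rw [this, H, H2, sub_self]
  have hz := model_adjoint_no_regular_annihilator (φ := fun σ => φ₁ σ - φ₂ σ) (φ' := fun σ => φ₁' σ - φ₂' σ)
    hab hε hk hkev hw hφ hw'c hφ'c hwa hwb hgrowth heq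
  intro σ hσ
  exact sub_eq_zero.1 (hz σ hσ)

end Summit.NavierStokesRegularity.NavierStokesRegularity.Theorems.Clause13REdgeMeasureModelConverse

end
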